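import Summits.QuantumFields.BalabanUV.T4Continuum.Support.VariationalColourRegularityRho
import Summits.QuantumFields.BalabanUV.T4Continuum.Support.VariationalColourUpperBoundData
import Summits.QuantumFields.BalabanUV.T4Continuum.Support.VariationalColourPoincarePhys
import Summits.QuantumFields.BalabanUV.T4Continuum.Support.VariationalCovariantAssemblySqrt
import Summits.QuantumFields.BalabanUV.T4Continuum.Support.VariationalCovariantUpperSqrt

/-!
# T⁴ programme, spine node NE2 (U1a), lane P2 — SUPPLIER ITEM «V-COL-CLOSED», file D: THE COLOUR CANONICAL PAIR, CLOSED — the additive bracket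
# `|Δ′_{k+1}(μ) − Δ′_k(μ)| ≤ (e + e′)·Σ‖μ‖²` for 0-forms with values in a finite-dimensional Hilbert space `E` transported by OPERATORS, with ALL
# FIVE LEAVES DISCHARGED BY NAME (UB⁺ ← leaf-03-g4, P⁺ ∕ ONE⁺ ∕ FED⁺ ← leaf-02-g4, REG⁺ ← files A–C of this item), leaving ONLY DATA hypotheses
# (the colour twin of leaf-09-g3's `VariationalCovariantScalarPairClosed.scalar_pair_closed`, p213521)

NE2 formalisation swarm `b2b-balaban-t4-ne2-formalise-*`, leaf prover 02 (gen 5); register P2-sup, item «V-COL-CLOSED» (INTENT CLAIMS.log l.14931);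
P2 skeleton `t4/skeletons/NE2-t4-ne2-p2.md` v0.15 §2.E row V-COL.  COMPOSITION ONLY, of tree theorems BY NAME:
 * the ABSTRACT brackets `VariationalCovariantUpperSqrt.fine_ub_of_coarse_sqrt` (leaf-01-g2, p213284) and
   `VariationalCovariantAssemblySqrt.pair_bracket_sqrt` (leaf-01-g2, p212859) — generic in the carriers, so NO colour twin is needed;
 * the colour letters `VariationalColourScalarPair.{Scv, Sfv, qWv, qVv, Qkv, Q1v, Scv_Q1v_le (FED⁺), Q1v_surjective, …}` (leaf-02-g4, p215316);
 * UB⁺-colour `VariationalColourUpperBound.exists_ubv_phys` + `…Data.unitary_data ∕ inBlock_of_blockOf` (leaf-03-g4, p215022 ∕ p215090);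
 * P⁺-colour `VariationalColourPoincarePhys.qWv_le_coarse_local ∕ qVv_le_composite_local` (leaf-02-g4, p216531; `C_P = 136`, frame-free);
 * ONE⁺-colour `VariationalColourOneStepPhys.blockSpin_Q1v_le` (leaf-02-g4, p215426; square-root shape, `ρ = rhov`);
 * REG⁺-colour `VariationalColourRegularityRho.hREG_rhov` (this item, file C).

THE STATEMENT (`colour_pair_closed`).  DATA: UNITARY level-`n` bond operators `Rc` with plaquette defect `a` (operator norm) and in-block defect `w`
against UNITARY level-`n` site operators `T` (`‖Rc(x,μ)∘T(x+e_μ)⋆∘T(x) − 1‖ ≤ w` on bonds inside one block); contractive level-`nL` bond operators `R′`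
with in-block defect `w′` against UNITARY one-step site operators `T′`; one-step defects `m₁` of `(R′, T′, Rc)`; one-block transport mismatch `m`
of `(Rc, R′, T′)`; three LOCAL small-field absorptions `2d(n w)² ≤ ½`, `2d(L w′)² ≤ ½`, `64d(n m)² ≤ ½` (NO global frames — the colour P⁺ is local).
With `Λc := 2d·36^d·((1 + n w)² + 9)` (UB⁺), `C_P := 136` (P⁺), `C_R := 2Λc + 2d·(a n²) + d²·(a n²)²·C_P` (REG⁺), `ε₁ := (d/4 + ½)·(L/n²)`,
`δ′ := √(2d(1+d²))·(n L m₁)` (ONE⁺), `Λ := Λc + (ε₁C_R + 2δ′√((1+ε₁C_R)·C_P) + δ′²C_P)·(Λc+1)` (the common UB⁺ constant at both levels), `δ := √d·(n m)`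
(FED⁺): for every unit datum `μ : Tor M → E`,

  `Δ′_k(μ) ≤ Δ′_{k+1}(μ) + (2δ√(Λ·C_P(Λ+1)) + δ²C_P(Λ+1))·Σ‖μ‖²`,
  `Δ′_{k+1}(μ) ≤ Δ′_k(μ) + (ε₁C_R(Λ+1) + 2δ′√((Λ + ε₁C_R(Λ+1))·C_P(Λ+1)) + δ′²C_P(Λ+1))·Σ‖μ‖²`

(`Δ′_k := blockSpin (Qkv n M T) (Scv n M Rc)`, `Δ′_{k+1} := blockSpin (Qkv n M T ∘ Q1v n L M T′) (Sfv n L M R′)`).  SAME constants as the scalar closed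
pair except `C_P = 136` (local colour Poincaré) for `1088d + 128` (global frames); for the unit-smooth class (`m, m₁ ≍ α·n⁻²…`, `w ≍ α/n`,
`a ≍ α/n²`) every constant is k-UNIFORM and `e + e′ ≍ α·L^{−k} + L^{−2k}`.

HONEST FRAMING (T4-DAG p. 1).  MODEL LEVEL: operators `Rc, R′, T, T′` and the defects are DATA; no identification with Bałaban's `U(Γ)` ∕ `R(U)` of
[B9] (3.8)–(3.15) (c5, no B0); [folklore] composition; nothing printed is a hypothesis; no `def … : Prop`; no `sorry`; axioms standard.  What is NOT
here: the tower (COMP⁺-colour `VariationalColourTower` + the END pattern; the scalar road's composition caveats N-ne2p2g11-2 ∕ G-ne2leaf04g2-1 apply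
verbatim), node NE3, 1-forms.  NE2 NOT proved; spine PROVED 0∕9; rung (B)+1 finite T⁴ — NOT infinite volume, NOT a mass gap, NOT Clay.  HONEST
DEPENDENCY (cell, verbatim): continuum YM on T⁴ ⇐ BetaPertH ∧ nine spine estimates (0/9 proved); BetaPertH ⇐ (D1) ∧ (D4) ∧ CAP+tail; G-an2-4
gates asym, D1 and NE2/3/4.
-/

noncomputable section

namespace Summit.QuantumFields.BalabanUV.T4Continuum.VariationalColourScalarPairClosed

open Finset
open Literature.MathematicalPhysics.QuantumFieldTheory.Balaban1983to89
open Literature.MathematicalPhysics.QuantumFieldTheory.Balaban1983to89.B5Prop11Plancherel (Tor fine unitVec)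
open Literature.MathematicalPhysics.QuantumFieldTheory.Balaban1983to89.B5Block118 (bpt)
open Literature.MathematicalPhysics.QuantumFieldTheory.Balaban1983to89.B5Blocks16 (blockOf)
open Summit.QuantumFields.BalabanUV.T4Continuum.VariationalTransfer (blockSpin)
open Summit.QuantumFields.BalabanUV.T4Continuum.VariationalColourFederbush (dirUv misv norm_le_one_of_mem_unitary)
open Summit.QuantumFields.BalabanUV.T4Continuum.VariationalColourUpperBound (nsqv nsqv_nonneg exists_ubv_phys unitary_data inBlock_of_blockOf)
open Summit.QuantumFields.BalabanUV.T4Continuum.VariationalColourScalarPair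
  (Scv Sfv qWv qVv Qkv Q1v Scv_nonneg Sfv_nonneg qWv_nonneg qVv_nonneg norm_sq_le_qWv norm_sq_le_qVv continuous_Qcv continuous_sum_dirUv
   Q1v_surjective Scv_Q1v_le)
open Summit.QuantumFields.BalabanUV.T4Continuum.VariationalColourPoincarePhys (qWv_le_coarse_local qVv_le_composite_local)
open Summit.QuantumFields.BalabanUV.T4Continuum.VariationalColourOneStepPhys (rhov rhov_nonneg blockSpin_Q1v_le)
open Summit.QuantumFields.BalabanUV.T4Continuum.VariationalColourRegularityRho (hREG_rhov Scv_eq)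
open Summit.QuantumFields.BalabanUV.T4Continuum.VariationalCovariantAssemblySqrt (pair_bracket_sqrt)
open Summit.QuantumFields.BalabanUV.T4Continuum.VariationalCovariantUpperSqrt (fine_ub_of_coarse_sqrt)

variable {d : ℕ} {E : Type*} [NormedAddCommGroup E] [InnerProductSpace ℂ E] [CompleteSpace E] [FiniteDimensional ℂ E]
variable (n L : ℕ) [NeZero n] [NeZero L] (M : Fin d → ℕ) [hM : ∀ μ, NeZero (M μ)]

omit [NeZero L] [FiniteDimensional ℂ E] in
/-- **UB⁺-colour in the colour pair's letters** for UNITARY data: `∀ ν, ∃ f, Qkv T f = ν ∧ Scv f ≤ 2d·36^d·((1 + n w)² + 9)·Σ‖ν‖²` from leaf-03-g4's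
`exists_ubv_phys` with `S := T⋆` and the in-block defect in block form. [folklore] -/
theorem hUBc_colour {Rc : Tor (fine n M) → Fin d → (E →L[ℂ] E)} {T : Tor (fine n M) → (E →L[ℂ] E)}
    (hT : ∀ x, T x ∈ unitary (E →L[ℂ] E)) (hRc : ∀ x μ, Rc x μ ∈ unitary (E →L[ℂ] E)) {w : ℝ} (hw0 : 0 ≤ w)
    (hw : ∀ (x : Tor (fine n M)) (μ : Fin d), blockOf n M (x + unitVec (fine n M) μ) = blockOf n M x →
      ‖Rc x μ * star (T (x + unitVec (fine n M) μ)) * T x - 1‖ ≤ w) :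
    ∀ ν : Tor M → E, ∃ f, Qkv n M T f = ν ∧ Scv n M Rc f ≤ 2 * d * (36 : ℝ) ^ d * ((1 + n * w) ^ 2 + 9) * nsqv ν := by
  intro ν
  obtain ⟨hTS, hT1, hS1⟩ := unitary_data n M hT
  obtain ⟨f, hf, hb⟩ := exists_ubv_phys n M (T := T) (S := fun x => star (T x)) hTS hT1 hS1 (R := Rc)
    (fun x μ => norm_le_one_of_mem_unitary (hRc x μ)) hw0 (inBlock_of_blockOf n M (T := T) (S := fun x => star (T x)) (R := Rc) hw) ν
  refine ⟨f, hf, ?_⟩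
  rw [Scv_eq]
  have e : (n : ℝ) ^ 2 / (n : ℝ) ^ d * ∑ μ, dirUv (fine n M) Rc f μ = ((n : ℝ) ^ d)⁻¹ * ((n : ℝ) ^ 2 * ∑ μ, dirUv (fine n M) Rc f μ) := by
    ring
  rw [e]
  exact hb

/-- **THE COLOUR CANONICAL PAIR, ALL LEAVES DISCHARGED** (model level; finite-dimensional Hilbert space `E`; only DATA hypotheses remain). [folklore] -/
theorem colour_pair_closed {Rc : Tor (fine n M) → Fin d → (E →L[ℂ] E)} {R' : Tor (fine L (fine n M)) → Fin d → (E →L[ℂ] E)}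
    {T : Tor (fine n M) → (E →L[ℂ] E)} {T' : Tor (fine L (fine n M)) → (E →L[ℂ] E)}
    -- level-n data: UNITARY site and bond operators, in-block defect `w` (UB⁺ ∕ P⁺), plaquette defect `a` (REG⁺)
    (hT : ∀ x, T x ∈ unitary (E →L[ℂ] E)) (hRc : ∀ x μ, Rc x μ ∈ unitary (E →L[ℂ] E)) {w : ℝ} (hw0 : 0 ≤ w)
    (hw : ∀ (x : Tor (fine n M)) (μ : Fin d), blockOf n M (x + unitVec (fine n M) μ) = blockOf n M x →
      ‖Rc x μ * star (T (x + unitVec (fine n M) μ)) * T x - 1‖ ≤ w)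
    (hsmall : 2 * (d : ℝ) * ((n : ℝ) * w) ^ 2 ≤ 1 / 2)
    {a : ℝ} (ha : 0 ≤ a)
    (hP : ∀ x μ ν, ‖Rc x μ * Rc (x + unitVec (fine n M) μ) ν - Rc x ν * Rc (x + unitVec (fine n M) ν) μ‖ ≤ a)
    -- level-nL data: UNITARY one-step site operators, contractive bond operators, in-block defect `w′` (P⁺ one step up)
    (hT' : ∀ x, T' x ∈ unitary (E →L[ℂ] E)) (hR' : ∀ x μ, ‖R' x μ‖ ≤ 1) {w' : ℝ}
    (hw' : ∀ (x : Tor (fine L (fine n M))) (μ : Fin d), blockOf L (fine n M) (x + unitVec (fine L (fine n M)) μ) = blockOf L (fine n M) x →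
      ‖R' x μ * star (T' (x + unitVec (fine L (fine n M)) μ)) * T' x - 1‖ ≤ w')
    (hsmall' : 2 * (d : ℝ) * ((L : ℝ) * w') ^ 2 ≤ 1 / 2)
    -- FED⁺ data: one-block transport mismatch `m`
    {m : ℝ} (hm : 0 ≤ m) (hmis : ∀ y μ j, ‖misv L (fine n M) Rc R' T' y μ j‖ ≤ m) (habsorb : 64 * (d : ℝ) * ((n : ℝ) * m) ^ 2 ≤ 1 / 2)
    -- ONE⁺ data: one-step in-block ∕ crossing defects `m₁` of `(R′, T′, Rc)`
    {m₁ : ℝ} (hm₁ : 0 ≤ m₁)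
    (hin : ∀ (y : Tor (fine n M)) (j : Fin d → Fin L) (μ : Fin d), (j μ : ℕ) + 1 < L →
      ‖R' (bpt L (fine n M) y j) μ * star (T' (bpt L (fine n M) y j + unitVec (fine L (fine n M)) μ)) - star (T' (bpt L (fine n M) y j))‖ ≤ m₁)
    (hcross : ∀ (y : Tor (fine n M)) (j : Fin d → Fin L) (μ : Fin d), (j μ : ℕ) + 1 = L →
      ‖R' (bpt L (fine n M) y j) μ * star (T' (bpt L (fine n M) y j + unitVec (fine L (fine n M)) μ))
        - star (T' (bpt L (fine n M) y j)) * Rc y μ‖ ≤ m₁)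
    (μ : Tor M → E) :
    let Λc : ℝ := 2 * d * (36 : ℝ) ^ d * ((1 + n * w) ^ 2 + 9)
    let CP : ℝ := 136
    let CR : ℝ := 2 * Λc + 2 * d * (a * (n : ℝ) ^ 2) + (d : ℝ) ^ 2 * (a * (n : ℝ) ^ 2) ^ 2 * CP
    let ε₁ : ℝ := ((d : ℝ) / 4 + 1 / 2) * ((L : ℝ) / (n : ℝ) ^ 2)
    let δ' : ℝ := Real.sqrt (2 * d * (1 + (d : ℝ) ^ 2)) * ((n : ℝ) * L * m₁)
    let Λ : ℝ := Λc + (ε₁ * CR + 2 * δ' * Real.sqrt ((1 + ε₁ * CR) * CP) + δ' ^ 2 * CP) * (Λc + 1)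
    blockSpin (Qkv n M T) (Scv n M Rc) μ ≤ blockSpin (Qkv n M T ∘ Q1v n L M T') (Sfv n L M R') μ
        + (2 * (Real.sqrt d * ((n : ℝ) * m)) * Real.sqrt (Λ * (CP * (Λ + 1)))
            + (Real.sqrt d * ((n : ℝ) * m)) ^ 2 * (CP * (Λ + 1))) * nsqv μ ∧
      blockSpin (Qkv n M T ∘ Q1v n L M T') (Sfv n L M R') μ ≤ blockSpin (Qkv n M T) (Scv n M Rc) μ
        + (ε₁ * CR * (Λ + 1) + 2 * δ' * Real.sqrt ((Λ + ε₁ * CR * (Λ + 1)) * (CP * (Λ + 1)))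
            + δ' ^ 2 * (CP * (Λ + 1))) * nsqv μ := by
  intro Λc CP CR ε₁ δ' Λ
  have hn0 : (0 : ℝ) < n := by exact_mod_cast Nat.pos_of_ne_zero (NeZero.ne n)
  have hL1 : (1 : ℝ) ≤ L := by exact_mod_cast Nat.one_le_iff_ne_zero.mpr (NeZero.ne L)
  have hd : (0 : ℝ) ≤ d := Nat.cast_nonneg d
  have hΛc : 0 ≤ Λc := by positivity
  have hCP : 0 ≤ CP := by norm_num
  have hα : 0 ≤ a * (n : ℝ) ^ 2 := by positivity
  have hCR : 0 ≤ CR := by positivity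
  have hε₁ : 0 ≤ ε₁ := by positivity
  have hδ' : 0 ≤ δ' := by positivity
  have hetil : 0 ≤ (ε₁ * CR + 2 * δ' * Real.sqrt ((1 + ε₁ * CR) * CP) + δ' ^ 2 * CP) * (Λc + 1) := by positivity
  have hΛ : 0 ≤ Λ := add_nonneg hΛc hetil
  have hδ : 0 ≤ Real.sqrt d * ((n : ℝ) * m) := by positivity
  have hT1 : ∀ x, ‖T' x‖ ≤ 1 := fun x => norm_le_one_of_mem_unitary (hT' x)
  -- UB⁺-colour at level n (leaf-03-g4), in the pair's letters
  have hUBc0 : ∀ ν : Tor M → E, ∃ f, Qkv n M T f = ν ∧ Scv n M Rc f ≤ Λc * nsqv ν := hUBc_colour n M hT hRc hw0 hw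
  -- P⁺-colour at both levels (leaf-02-g4), `C_P = 136`
  have hPc : ∀ f, qWv n M f ≤ CP * (Scv n M Rc f + nsqv (Qkv n M T f)) := fun f => qWv_le_coarse_local n M hT hw hsmall f
  have hPf : ∀ f', qVv n L M f' ≤ CP * (Sfv n L M R' f' + nsqv (Qkv n M T (Q1v n L M T' f'))) := fun f' =>
    qVv_le_composite_local n L M hT hw hsmall hT' hw' hsmall' hR' hm hmis habsorb f'
  -- ONE⁺-colour (leaf-02-g4), square-root shape
  have hONE : ∀ f, blockSpin (Q1v n L M T') (Sfv n L M R') f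
      ≤ (Real.sqrt (Scv n M Rc f + ε₁ * rhov n M Rc f) + δ' * Real.sqrt (qWv n M f)) ^ 2 := fun f =>
    blockSpin_Q1v_le n L M hT' hRc hm₁ hin hcross f
  -- REG⁺-colour (this item, file C), for leaf ONE⁺'s `rhov`
  have hREG : ∀ (ν : Tor M → E) f, Qkv n M T f = ν → (∀ g, Qkv n M T g = ν → Scv n M Rc f ≤ Scv n M Rc g) →
      rhov n M Rc f ≤ CR * (Scv n M Rc f + nsqv ν) := hREG_rhov n M hT hRc ha hP hΛc hUBc0 hPc
  -- FED⁺-colour (leaf-02-g4, inside the pair file)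
  have hFED : ∀ f', Scv n M Rc (Q1v n L M T' f')
      ≤ (Real.sqrt (Sfv n L M R' f') + Real.sqrt d * ((n : ℝ) * m) * Real.sqrt (qVv n L M f')) ^ 2 := fun f' =>
    Scv_Q1v_le n L M hR' hT1 hm hmis f'
  -- the structure hypotheses of the abstract lemmas
  have hnLd : (0 : ℝ) ≤ ((n : ℝ) * L) ^ d := by positivity
  have hnormW : ∀ f : Tor (fine n M) → E, ‖f‖ ^ 2 ≤ ((n : ℝ) * L) ^ d * qWv n M f := by
    intro f
    refine (norm_sq_le_qWv n M f).trans (mul_le_mul_of_nonneg_right ?_ (qWv_nonneg n M f))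
    rw [mul_pow]
    exact le_mul_of_one_le_right (by positivity) (one_le_pow₀ hL1)
  have hnormV : ∀ f' : Tor (fine L (fine n M)) → E, ‖f'‖ ^ 2 ≤ ((n : ℝ) * L) ^ d * qVv n L M f' := norm_sq_le_qVv n L M
  -- UB⁺ one level up from the coarse one, square-root world (leaf-01-g2's ABSTRACT `fine_ub_of_coarse_sqrt`, no colour twin needed)
  have hUBf : ∀ ν : Tor M → E, ∃ f', Qkv n M T (Q1v n L M T' f') = ν ∧ Sfv n L M R' f' ≤ Λ * nsqv ν := by
    intro ν
    exact fine_ub_of_coarse_sqrt (V := Tor (fine L (fine n M)) → E) (W := Tor (fine n M) → E) (Z := Tor M → E)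
      (Qk := Qkv n M T) (Q₁ := Q1v n L M T') (Sc := Scv n M Rc) (Sf := Sfv n L M R') (qW := qWv n M) (qV := qVv n L M) (qZ := nsqv)
      (ρ := rhov n M Rc) (continuous_Qcv T) (continuous_Qcv T') (continuous_sum_dirUv Rc _) (continuous_sum_dirUv R' _)
      (Q1v_surjective n L M T' hT') (Scv_nonneg n M Rc) (Sfv_nonneg n L M R') (qWv_nonneg n M) (fun μ => nsqv_nonneg μ)
      (rhov_nonneg n M Rc) hnLd hnLd hΛc hCP hCR hε₁ hδ' hnormW hnormV hUBc0 hPc hPf hONE hREG ν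
  -- the coarse UB⁺ with the common (larger) constant
  have hUBc : ∀ ν : Tor M → E, ∃ f, Qkv n M T f = ν ∧ Scv n M Rc f ≤ Λ * nsqv ν := by
    intro ν
    obtain ⟨f, hf, hb⟩ := hUBc0 ν
    exact ⟨f, hf, hb.trans (mul_le_mul_of_nonneg_right (le_add_of_nonneg_right hetil) (nsqv_nonneg ν))⟩
  exact pair_bracket_sqrt (V := Tor (fine L (fine n M)) → E) (W := Tor (fine n M) → E) (Z := Tor M → E)
    (Qk := Qkv n M T) (Q₁ := Q1v n L M T') (Sc := Scv n M Rc) (Sf := Sfv n L M R') (qW := qWv n M) (qV := qVv n L M) (qZ := nsqv)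
    (ρ := rhov n M Rc) (continuous_Qcv T) (continuous_Qcv T') (continuous_sum_dirUv Rc _) (continuous_sum_dirUv R' _)
    (Q1v_surjective n L M T' hT') (Scv_nonneg n M Rc) (Sfv_nonneg n L M R') (qVv_nonneg n L M) (qWv_nonneg n M) (fun μ => nsqv_nonneg μ)
    (rhov_nonneg n M Rc) hnLd hΛ hCP hCR hδ hε₁ hδ' hnormW hnormV hUBc hUBf hPc hPf hFED hONE hREG μ

end Summit.QuantumFields.BalabanUV.T4Continuum.VariationalColourScalarPairClosed

end
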